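import Summits.ValiantsHypothesis.ValiantsHypothesis.Theorems.LacunarySymmetroidMatrixDescartesZeroChangeStateOmegaLC
import Summits.ValiantsHypothesis.ValiantsHypothesis.Theorems.LacunarySymmetroidMatrixDescartesZeroChangeStateEdgeDictionary
import HarnessLib

/-!
# LINE (A) `product_plus_one` — r = 1 rung: **THEOREM E∞ — `OmegaLogConcave k` for EVERY `k`, unconditional** (and (P-U2) for every `k`)

Crux item stmt-ValiantsHypothesis-18050 (`MatrixDescartes`), LINE (A) `Lines/product_plus_one.lean` (skeleton 4c66814e33f05045), floor
`OneChangeFloorK3`, r = 1 rung «one W row × k zero-change rows».  Pen val-idea-25 g9 NOTE §56.24 THEOREM E∞ (crit-1 #430's CONJECTURE E /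
ΩLC; refereed crit-1 #434, crit-6 #105): at every feasible state with `Ω > 0`, `Ω·Ω″ < Ω′²` — `u ↦ log Ω_B(u)` is strictly concave on every
component of `U⁺` — for EVERY number `k` of zero-change rows and every ratio `ρ > 1`.  KERNEL: `OmegaLogConcave_of_edgeAgg` (`…OmegaLC`:
ρ-elimination in aggregate coordinates, simplex-Bernstein aggregation over `Fin k`, vertex certificate) applied to `edgeAgg_nonneg`
(`…EdgeDictionary`: the pen's k-free edge charging certificate transported to aggregate coordinates).  Consequence by crit-1's kernel chain
(`OmegaLogConcave_implies_PointwiseU2`, `…OneRow`): the pen's (★)/(P-U2) for every `k` — on `U⁺` the block quotient `F_B` has only local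
maxima (the (U2)-half of T3♮).

No `def`, no named fact, no sorry, no hypothesis.  HONEST FRAMING: THEOREM E∞ is the (U2)-HALF of the r = 1 rung; (U1) for `k ≥ 3 ∧ c > 2a`,
the T3♮ ⇒ T3♯ reduction (paper), r ≥ 2 and the A-LAW (= the floor `OneChangeFloorK3`) remain OPEN; nothing here closes
`stub_oneChangeFloorK3` or any stub of LINE (A); 18050 / `MatrixDescartes` OPEN; `VP ≠ VNP` is NOT proved.
-/

set_option linter.dupNamespace false

namespace Summit.ValiantsHypothesis.ValiantsHypothesis.Theorems.LacunarySymmetroidMatrixDescartes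

namespace ZeroChangeState

/-- **THEOREM E∞ (pen val-idea-25 g9 §56.24; crit-1 #430's CONJECTURE E / ΩLC), every `k`, unconditional:** `OmegaLogConcave k`. -/
theorem OmegaLogConcave_all (k : ℕ) : OmegaLogConcave k :=
  OmegaLogConcave_of_edgeAgg edgeAgg_nonneg k

/-- **(P-U2)/(★) for every `k`** (pen §56.17/§56.24, crit-1 #430 (2)): inside `U⁺ = {Ω > 0}` every zero of `K = Ω′ − (ρ+κ₁)Ω` is a strict
down-crossing, for every number `k` of zero-change rows and every `ρ > 1`. -/
theorem PointwiseU2_all (k : ℕ) : PointwiseU2 k :=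
  OmegaLogConcave_implies_PointwiseU2 k (OmegaLogConcave_all k)

end ZeroChangeState

end Summit.ValiantsHypothesis.ValiantsHypothesis.Theorems.LacunarySymmetroidMatrixDescartes
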